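import Literature.Analysis.FluidPDE.HardSphereCollisionRecord
import Literature.Analysis.FluidPDE.HardSphereRegularGeometry
import Literature.Analysis.FunctionSpaces.HolderNormProofs
import Literature.MathematicalPhysics.KineticTheory.HardSphereEuler

/-!
# Record kinematics for the adapted-clamp stub (`stub_adaptedClampKinematics`, line `coarse-coin-entropy-chain`)

Crux `Summit.AtomisticToContinuum.HydrodynamicLimit.Theses.TwoClocks.EquilibriumClampedCollisionalWindowLD`
(stmt-AtomisticToContinuum-13733), line `coarse-coin-entropy-chain`, registered stub `stub_adaptedClampKinematics` (S2, held by the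
line lead). This file collects the ONE-RECORD facts the stub rests on, all elementary consequences of the elastic reflection law
`reflectVel n (v, w) = (v - c n, w + c n)`, `c = ⟪v - w, n⟫/‖n‖²` (GST 2013 (1.1.2)):

* `norm_fst_sub_reflectVel_fst_le` — the momentum impulse is at most the relative speed: `‖v - v⁻‖ ≤ ‖v⁻ - w⁻‖`
  (`|⟪g, n̂⟫| ≤ ‖g‖`, the reflection being an isometry on the relative velocity);
* `abs_norm_sq_sub_norm_sq_reflectVel_le` — the energy impulse is at most `‖g‖ · ‖U‖`, `U = (v⁻ + w⁻)/2`: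
  `|‖v‖² - ‖v⁻‖²|/2 ≤ ‖v⁻ - w⁻‖ · (½‖v⁻ + w⁻‖)` (since `‖v‖² - ‖v⁻‖² = c ⟪v⁻ + w⁻, n⟫`);
* `abs_apply_sub_apply_le_norm_sub` — a velocity component moves at most by the norm;
* twin records in a regular geometry (`ofConfig_swap_preVel`, `ofConfig_swap_postVel`): at contact the record of `(j, i)` carries the
  swapped pre- and post-velocities of the record of `(i, j)` (oddness of the separation vector, `reflectVel_neg`, `reflectVel_swap`), hence
  the same momentum impulse and the same absolute energy impulse (`norm_sub_swap_eq`, `abs_sq_sub_swap_eq`: conservation laws);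
* `adaptedClampKinematics_lipschitz` (registered sub-goal of the stub) — a smooth function on `𝕋³` is Lipschitz for the minimal-image distance.

References: I. Gallagher, L. Saint-Raymond, B. Texier, *From Newton to Boltzmann* (2013), (1.1.2)–(1.1.3), §4.1;
C. Cercignani, R. Illner, M. Pulvirenti, *The Mathematical Theory of Dilute Gases* (1994), §4.2.
-/

noncomputable section

open scoped InnerProductSpace
open Literature.Analysis.FluidPDE

namespace Summit.AtomisticToContinuum.HydrodynamicLimit.Theorems.ClampedTransferCoin

section Reflect

variable {E : Type*} [NormedAddCommGroup E] [InnerProductSpace ℝ E]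

/-- `reflectVel n p = (p.1 - c n, p.2 + c n)` with the reflection coefficient `c = ⟪v - w, n⟫ / ‖n‖²`. -/
theorem reflectVel_eq_rc (n : E) (p : E × E) :
    reflectVel n p = (p.1 - (⟪p.1 - p.2, n⟫_ℝ / ‖n‖ ^ 2) • n, p.2 + (⟪p.1 - p.2, n⟫_ℝ / ‖n‖ ^ 2) • n) := rfl

/-- The jump of the first velocity is `c n`: `p.1 - (reflectVel n p).1 = c • n`. -/
theorem fst_sub_reflectVel_fst (n : E) (p : E × E) :
    p.1 - (reflectVel n p).1 = (⟪p.1 - p.2, n⟫_ℝ / ‖n‖ ^ 2) • n := by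
  rw [reflectVel_eq_rc]
  exact sub_sub_cancel _ _

/-- The relative velocity AFTER undoing the reflection: `(v⁻ - w⁻) = (v - w) - 2c n`. -/
theorem reflectVel_fst_sub_snd (n : E) (p : E × E) :
    (reflectVel n p).1 - (reflectVel n p).2 = (p.1 - p.2) - (2 * (⟪p.1 - p.2, n⟫_ℝ / ‖n‖ ^ 2)) • n := by
  rw [reflectVel_eq_rc, mul_smul, two_smul]
  set x := (⟪p.1 - p.2, n⟫_ℝ / ‖n‖ ^ 2) • n
  simp only
  abel

/-- The reflection is an isometry on the relative velocity: `‖v⁻ - w⁻‖ = ‖v - w‖`. -/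
theorem norm_reflectVel_fst_sub_snd (n : E) (p : E × E) :
    ‖(reflectVel n p).1 - (reflectVel n p).2‖ = ‖p.1 - p.2‖ := by
  by_cases hn : n = 0
  · simp [hn]
  have hn2 : ‖n‖ ^ 2 ≠ 0 := pow_ne_zero 2 (norm_ne_zero_iff.2 hn)
  rw [reflectVel_fst_sub_snd, ← sq_eq_sq₀ (norm_nonneg _) (norm_nonneg _), norm_sub_sq_real,
    norm_smul, inner_smul_right, Real.norm_eq_abs, mul_pow, sq_abs]
  field_simp
  ring

/-- `‖c • n‖ = |⟪v - w, n⟫| / ‖n‖` for `n ≠ 0`, and in any case `≤ ‖v - w‖` (Cauchy–Schwarz). -/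
theorem norm_coef_smul_le (n : E) (p : E × E) : ‖(⟪p.1 - p.2, n⟫_ℝ / ‖n‖ ^ 2) • n‖ ≤ ‖p.1 - p.2‖ := by
  by_cases hn : n = 0
  · simp [hn]
  have hnpos : 0 < ‖n‖ := norm_pos_iff.2 hn
  rw [norm_smul, Real.norm_eq_abs, abs_div, abs_of_pos (pow_pos hnpos 2)]
  have hcs : |⟪p.1 - p.2, n⟫_ℝ| ≤ ‖p.1 - p.2‖ * ‖n‖ := abs_real_inner_le_norm _ _
  calc |⟪p.1 - p.2, n⟫_ℝ| / ‖n‖ ^ 2 * ‖n‖ = |⟪p.1 - p.2, n⟫_ℝ| / ‖n‖ := by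
        field_simp
    _ ≤ ‖p.1 - p.2‖ * ‖n‖ / ‖n‖ := div_le_div_of_nonneg_right hcs hnpos.le
    _ = ‖p.1 - p.2‖ := by field_simp

/-- **Momentum impulse ≤ relative speed**: `‖v - v⁻‖ ≤ ‖v⁻ - w⁻‖` for `(v⁻, w⁻) = reflectVel n (v, w)`. -/
theorem norm_fst_sub_reflectVel_fst_le (n : E) (p : E × E) :
    ‖p.1 - (reflectVel n p).1‖ ≤ ‖(reflectVel n p).1 - (reflectVel n p).2‖ := by
  rw [fst_sub_reflectVel_fst, norm_reflectVel_fst_sub_snd]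
  exact norm_coef_smul_le n p

/-- The energy jump of the first particle: `‖v‖² - ‖v⁻‖² = ⟪c n, v⁻ + w⁻⟫`... precisely
`‖p.1‖² - ‖(reflectVel n p).1‖² = ⟪p.1 - (reflectVel n p).1, (reflectVel n p).1 + (reflectVel n p).2⟫`. -/
theorem norm_sq_sub_norm_sq_reflectVel (n : E) (p : E × E) :
    ‖p.1‖ ^ 2 - ‖(reflectVel n p).1‖ ^ 2 =
      ⟪p.1 - (reflectVel n p).1, (reflectVel n p).1 + (reflectVel n p).2⟫_ℝ := by
  have key : (⟪p.1 - p.2, n⟫_ℝ / ‖n‖ ^ 2) * ‖n‖ ^ 2 = ⟪p.1, n⟫_ℝ - ⟪p.2, n⟫_ℝ := by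
    by_cases hn : n = 0
    · simp [hn]
    · have hn2 : ‖n‖ ^ 2 ≠ 0 := pow_ne_zero 2 (norm_ne_zero_iff.2 hn)
      rw [← inner_sub_left]
      field_simp
  rw [fst_sub_reflectVel_fst, reflectVel_fst_add_reflectVel_snd]
  -- expand `‖v - c n‖²`
  have hexp : ‖(reflectVel n p).1‖ ^ 2 = ‖p.1‖ ^ 2 - 2 * ((⟪p.1 - p.2, n⟫_ℝ / ‖n‖ ^ 2) * ⟪p.1, n⟫_ℝ) + (⟪p.1 - p.2, n⟫_ℝ / ‖n‖ ^ 2) ^ 2 * ‖n‖ ^ 2 := by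
    rw [reflectVel_eq_rc]
    simp only
    rw [norm_sub_sq_real, inner_smul_right, norm_smul, mul_pow, Real.norm_eq_abs, sq_abs]
  rw [hexp, inner_smul_left, inner_add_right]
  simp only [RCLike.conj_to_real]
  rw [real_inner_comm p.1 n, real_inner_comm p.2 n]
  linear_combination (-((⟪p.1 - p.2, n⟫_ℝ / ‖n‖ ^ 2))) * key

/-- **Energy impulse ≤ relative speed × centre-of-mass speed**:
`|‖v‖² - ‖v⁻‖²| / 2 ≤ ‖v⁻ - w⁻‖ · (½ ‖v⁻ + w⁻‖)`. -/
theorem abs_norm_sq_sub_norm_sq_reflectVel_le (n : E) (p : E × E) :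
    |‖p.1‖ ^ 2 - ‖(reflectVel n p).1‖ ^ 2| / 2 ≤
      ‖(reflectVel n p).1 - (reflectVel n p).2‖ * (2⁻¹ * ‖(reflectVel n p).1 + (reflectVel n p).2‖) := by
  rw [norm_sq_sub_norm_sq_reflectVel]
  have h1 := abs_real_inner_le_norm (p.1 - (reflectVel n p).1) ((reflectVel n p).1 + (reflectVel n p).2)
  have h2 := norm_fst_sub_reflectVel_fst_le n p
  have h3 : 0 ≤ ‖(reflectVel n p).1 + (reflectVel n p).2‖ := norm_nonneg _
  calc |⟪p.1 - (reflectVel n p).1, (reflectVel n p).1 + (reflectVel n p).2⟫_ℝ| / 2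
      ≤ ‖p.1 - (reflectVel n p).1‖ * ‖(reflectVel n p).1 + (reflectVel n p).2‖ / 2 :=
        div_le_div_of_nonneg_right h1 zero_le_two
    _ ≤ ‖(reflectVel n p).1 - (reflectVel n p).2‖ * ‖(reflectVel n p).1 + (reflectVel n p).2‖ / 2 :=
        div_le_div_of_nonneg_right (mul_le_mul_of_nonneg_right h2 h3) zero_le_two
    _ = ‖(reflectVel n p).1 - (reflectVel n p).2‖ * (2⁻¹ * ‖(reflectVel n p).1 + (reflectVel n p).2‖) := by
        ring

/-- The second particle's jumps mirror the first's: `w - w⁻ = -(v - v⁻)`. -/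
theorem snd_sub_reflectVel_snd (n : E) (p : E × E) :
    p.2 - (reflectVel n p).2 = -(p.1 - (reflectVel n p).1) := by
  rw [reflectVel_eq_rc]
  set x := (⟪p.1 - p.2, n⟫_ℝ / ‖n‖ ^ 2) • n
  simp only
  abel

/-- … and `‖w‖² - ‖w⁻‖² = -(‖v‖² - ‖v⁻‖²)` (energy conservation). -/
theorem norm_sq_snd_sub (n : E) (p : E × E) :
    ‖p.2‖ ^ 2 - ‖(reflectVel n p).2‖ ^ 2 = -(‖p.1‖ ^ 2 - ‖(reflectVel n p).1‖ ^ 2) := by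
  have h := norm_sq_reflectVel_fst_add_norm_sq_reflectVel_snd n p
  linarith

end Reflect

section Components

/-- A component moves at most by the norm of the jump: `|v k - v⁻ k| ≤ ‖v - v⁻‖` (a coordinate of a vector of `ℝ³` is at most
its Euclidean norm). -/
theorem abs_apply_sub_apply_le_norm_sub (x y : EuclideanSpace ℝ (Fin 3)) (k : Fin 3) :
    |x k - y k| ≤ ‖x - y‖ := by
  rw [← PiLp.sub_apply, EuclideanSpace.norm_eq]
  refine Real.abs_le_sqrt ?_
  calc (x - y) k ^ 2 = ‖(x - y) k‖ ^ 2 := by rw [Real.norm_eq_abs, sq_abs]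
    _ ≤ ∑ i, ‖(x - y) i‖ ^ 2 :=
        Finset.single_le_sum (f := fun i => ‖(x - y) i‖ ^ 2) (fun i _ => by positivity) (Finset.mem_univ k)

end Components

section Twin

variable {d : Type*} [Fintype d] {X : Type*} [TopologicalSpace X] {N : ℕ} {G : Geometry d X} {ε : ℝ}

/-- **Twin records, pre-velocities**: in a regular geometry, at a contact configuration of `(i, j)` the record of the ordered
pair `(j, i)` has the swapped pre-collisional velocities of the record of `(i, j)` (the separation vector is odd at distance
`≤ ε`, and the reflection law is even in `n` and equivariant under the swap). -/
theorem ofConfig_swap_preVel (hG : G.IsHardSphereRegular ε) {z : Config N d X} {i j : Fin N}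
    (hc : z ∈ contactSet G N ε i j) (t : ℝ) :
    (HardSphereCollisionRecord.ofConfig G ε z t j i).preVel =
      ((HardSphereCollisionRecord.ofConfig G ε z t i j).preVel.2,
        (HardSphereCollisionRecord.ofConfig G ε z t i j).preVel.1) := by
  have hle : ‖G.sepVec (z i).1 (z j).1‖ ≤ ε := (mem_contactSet.1 hc).2.le
  simp only [HardSphereCollisionRecord.ofConfig_preVel]
  rw [hG.sepVec_comm _ _ hle, reflectVel_neg]
  exact reflectVel_swap _ ((z i).2, (z j).2)

omit [TopologicalSpace X] in
/-- Twin records, post-velocities (definitional): the record of `(j, i)` has the swapped post-collisional velocities. -/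
theorem ofConfig_swap_postVel (z : Config N d X) (i j : Fin N) (t : ℝ) :
    (HardSphereCollisionRecord.ofConfig G ε z t j i).postVel =
      ((HardSphereCollisionRecord.ofConfig G ε z t i j).postVel.2,
        (HardSphereCollisionRecord.ofConfig G ε z t i j).postVel.1) := rfl

/-- **Twin records carry the same momentum impulse**: `‖v_j⁺ - v_j⁻‖ = ‖v_i⁺ - v_i⁻‖` (momentum conservation). -/
theorem norm_sub_swap_eq (hG : G.IsHardSphereRegular ε) {z : Config N d X} {i j : Fin N}
    (hc : z ∈ contactSet G N ε i j) (t : ℝ) :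
    ‖(HardSphereCollisionRecord.ofConfig G ε z t j i).postVel.1 -
        (HardSphereCollisionRecord.ofConfig G ε z t j i).preVel.1‖ =
      ‖(HardSphereCollisionRecord.ofConfig G ε z t i j).postVel.1 -
        (HardSphereCollisionRecord.ofConfig G ε z t i j).preVel.1‖ := by
  rw [ofConfig_swap_preVel hG hc t, ofConfig_swap_postVel z i j t]
  simp only [HardSphereCollisionRecord.ofConfig_postVel, HardSphereCollisionRecord.ofConfig_preVel]
  have h := snd_sub_reflectVel_snd (G.sepVec (z i).1 (z j).1) ((z i).2, (z j).2)
  simp only at h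
  rw [h, norm_neg]

/-- **Twin records carry the same absolute energy impulse**: `|‖v_j⁺‖² - ‖v_j⁻‖²| = |‖v_i⁺‖² - ‖v_i⁻‖²|`
(energy conservation). -/
theorem abs_sq_sub_swap_eq (hG : G.IsHardSphereRegular ε) {z : Config N d X} {i j : Fin N}
    (hc : z ∈ contactSet G N ε i j) (t : ℝ) :
    |‖(HardSphereCollisionRecord.ofConfig G ε z t j i).postVel.1‖ ^ 2 -
        ‖(HardSphereCollisionRecord.ofConfig G ε z t j i).preVel.1‖ ^ 2| =
      |‖(HardSphereCollisionRecord.ofConfig G ε z t i j).postVel.1‖ ^ 2 -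
        ‖(HardSphereCollisionRecord.ofConfig G ε z t i j).preVel.1‖ ^ 2| := by
  rw [ofConfig_swap_preVel hG hc t, ofConfig_swap_postVel z i j t]
  simp only [HardSphereCollisionRecord.ofConfig_postVel, HardSphereCollisionRecord.ofConfig_preVel]
  have h := norm_sq_snd_sub (G.sepVec (z i).1 (z j).1) ((z i).2, (z j).2)
  simp only at h
  rw [h, abs_neg]

end Twin

section Lipschitz

open Literature.Analysis.FunctionSpaces

/-- **A smooth function on `𝕋³` is Lipschitz for the minimal-image distance**: there is `L > 0` with
`|φ x - φ y| ≤ L · euclidDist x y` (mean-value inequality for the periodic lift, whose gradient is bounded; the two points are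
joined in `ℝ³` by the minimal-image segment `reprSym (x - y)`). -/
theorem adaptedClampKinematics_lipschitz {φ : UnitAddTorus (Fin 3) → ℝ} (hφ : Torus.IsSmooth φ) :
    ∃ L : ℝ, 0 < L ∧ ∀ x y : UnitAddTorus (Fin 3), |φ x - φ y| ≤ L * Torus.euclidDist x y := by
  -- the lift is Lipschitz with constant `K = ‖D (lift φ)‖_∞`
  have hK := hφ.lipschitzWith_iteratedFDeriv_lift 0
  set K := (eSupNorm (iteratedFDeriv ℝ (0 + 1) (Torus.lift φ))).toNNReal with hKdef
  refine ⟨(K : ℝ) + 1, by positivity, fun x y => ?_⟩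
  -- lift the two points: `b` over `y`, `a = b + reprSym (x - y)` over `x`
  set b : EuclideanSpace ℝ (Fin 3) := Torus.reprSym y with hb
  set a : EuclideanSpace ℝ (Fin 3) := b + Torus.reprSym (x - y) with ha
  have hpb : Torus.proj b = y := Torus.proj_reprSym y
  have hpa : Torus.proj a = x := by
    rw [ha, Torus.proj_add, hpb, Torus.proj_reprSym]
    abel
  have hdist : dist a b = Torus.euclidDist x y := by
    rw [dist_eq_norm, ha, add_sub_cancel_left]
    rfl
  -- `iteratedFDeriv ℝ 0 (lift φ)` is `lift φ` through a linear isometry, so `lift φ` is `K`-Lipschitz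
  have hL : LipschitzWith (1 * K) (Torus.lift φ) := by
    have h1 : LipschitzWith K
        (⇑(continuousMultilinearCurryFin0 ℝ (EuclideanSpace ℝ (Fin 3)) ℝ).symm ∘ Torus.lift φ) := by
      rw [← iteratedFDeriv_zero_eq_comp]
      exact hK
    have h2 := (continuousMultilinearCurryFin0 ℝ (EuclideanSpace ℝ (Fin 3)) ℝ).lipschitz.comp h1
    have hid : ⇑(continuousMultilinearCurryFin0 ℝ (EuclideanSpace ℝ (Fin 3)) ℝ) ∘
        (⇑(continuousMultilinearCurryFin0 ℝ (EuclideanSpace ℝ (Fin 3)) ℝ).symm ∘ Torus.lift φ) =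
        Torus.lift φ := by
      funext u
      simp
    rwa [hid] at h2
  have h0 := hL.dist_le_mul a b
  rw [one_mul, Torus.lift_apply, Torus.lift_apply, hpa, hpb, Real.dist_eq, hdist] at h0
  calc |φ x - φ y| ≤ K * Torus.euclidDist x y := h0
    _ ≤ (K + 1) * Torus.euclidDist x y := by
        have : 0 ≤ Torus.euclidDist x y := norm_nonneg _
        nlinarith

end Lipschitz

end Summit.AtomisticToContinuum.HydrodynamicLimit.Theorems.ClampedTransferCoin

end
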